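import Summits.BirchSwinnertonDyer.BirchSwinnertonDyer.Theses.SignedLowerHalves
import Summits.BirchSwinnertonDyer.BirchSwinnertonDyer.Theses.PrintX8VS
import Literature.NumberTheory.EllipticCurves.Sprung2012.SharpFlatColemanKatoZetaJoint
import Literature.NumberTheory.EllipticCurves.Sprung2012.SharpFlatKatoDivisibility
import Literature.NumberTheory.EllipticCurves.Kobayashi2013.SignedSimpleZero
import Summits.BirchSwinnertonDyer.BirchSwinnertonDyer.Theorems.PrintX8SharpFlatMuDefect
import Summits.BirchSwinnertonDyer.BirchSwinnertonDyer.Theorems.SignedLowerHalvesSprungLowerDivisibilityAtThreeColourTransfer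
import Summits.BirchSwinnertonDyer.BirchSwinnertonDyer.Theorems.SignedLowerHalvesSprungLowerDivisibilityAtThreeKatoFineLowerIff
import Summits.BirchSwinnertonDyer.BirchSwinnertonDyer.Theorems.SignedLowerHalvesSprungLowerDivisibilityAtThreeKatoFineSporadic
import Literature.NumberTheory.EllipticCurves.ModularCurvePeriodRatio
import Literature.NumberTheory.EllipticCurves.PlusMinusPAdicLFunction
import Literature.NumberTheory.EllipticCurves.AnalyticRank
import Literature.NumberTheory.EllipticCurves.LeadingTerm
import HarnessLib

/-!
# STUB-IDEAS k1 (technique: weaken / strengthen) for `stub_katoFineLowerSporadic` (K_spor) of the line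
# `chromatic-common-zeros` (skeleton v8, sha16 2f563411, stub at :153), crux K1 `SprungLowerDivisibilityAtThree`
# (item stmt-BirchSwinnertonDyer-19875). Typed sketch: every helper below ELABORATES; `sorry` only inside
# helper stubs. Nothing here registers a skeleton, touches the lead's line or closes an item; K1, BSD and leaf
# X8 are NOT proved by anything here.

* §0 `KSpor` — the registered stub's statement, verbatim, as a `Prop` (so the plans can be stated against it).
* §A (Plan A, RESHAPE R0 = the weakest sufficient telescope): `stub_katoFineLowerSporadic_rekeyed`
  (`h714 → h716 → h3 → KSpor`, precedent S4a) and `stub_heldInputs'` (S5 ∧ Sprung Thm 7.16).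
* §B (Plan B, the strongest form provable today): B1 `fine_le_zeta_offP_of_pow_mul_mem_charIdeal` (Kato's
  direction of the fine inequality, γ-keyed, fact-free given the OUTPUT of Thm 7.16), B2 `zeta_le_colour`,
  B3 `exists_defect_offP` (the Kato–Kolyvagin defect as ONE element `j`), B4 `zeta_le_fine_iff_defect_not_mem`.
* §C (Plan C) lives in `SketchC.lean` (per-pair composition with the tree's second-descent `BSD(E,3)` records).
-/

set_option autoImplicit false
-- justification: mirrors the skeleton of record (`Cruxes/…/Lines/chromatic_common_zeros.lean`), whose mandated
-- namespace repeats a segment by design (D-0017).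
set_option linter.dupNamespace false

noncomputable section

open scoped Classical NumberField MatrixGroups ModularForm

open NumberField IsDedekindDomain CongruenceSubgroup WeierstrassCurve
  Literature.NumberTheory.EllipticCurves Literature.NumberTheory.EllipticCurves.ModularForms
  Literature.NumberTheory.EllipticCurves.ZpExtension Literature.NumberTheory.EllipticCurves.Sprung2017
  Literature.NumberTheory.EllipticCurves.Sprung2012 Literature.NumberTheory.EllipticCurves.Rank1Residual
  Summit.BirchSwinnertonDyer.BirchSwinnertonDyer.Theorems

namespace Summit.BirchSwinnertonDyer.BirchSwinnertonDyer.Cruxes.SprungLowerDivisibilityAtThree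
namespace KatoFineSporadicK1

/-! ## §0 The registered stub, verbatim, as a `Prop` -/

/-- K_spor = `stub_katoFineLowerSporadic` (skeleton v8 :153–181), verbatim. -/
def KSpor : Prop :=
    ∀ (W : WeierstrassCurve ℚ) [W.IsElliptic] [W.IsGloballyMinimal] (p : ℕ) [Fact p.Prime]
      [ContinuousSMul ℤ_[p] (W.tateModule p)] [Module.Free ℤ_[p] (W.tateModule p)]
      [Module.Finite ℤ_[p] (W.tateModule p)],
      ClassX8 W p → ∀ (κ : ZpExtension ℚ p) (γ : Field.absoluteGaloisGroup ℚ),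
      κ.IsCyclotomic → κ.IsTopGenerator γ → IsCyclotomicVariable p γ →
    ∀ (v : HeightOneSpectrum (𝓞 ℚ)), (p : 𝓞 ℚ) ∈ v.asIdeal →
    ∀ (g : Field.absoluteGaloisGroup (v.adicCompletion ℚ)),
      κ.IsTopGenerator (resGalOfEmb (closureEmb (K := ℚ) (v.adicCompletion ℚ)) g) →
    ∀ (cneg : localPoints W (v.adicCompletion ℚ)) (c : ℕ → localPoints W (v.adicCompletion ℚ)),
      IsHondaSystem κ (closureEmb (K := ℚ) (v.adicCompletion ℚ)) W (W.frobeniusTrace p) g cneg c →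
    ∀ (N : ℕ) (_ : NeZero N) (f : CuspForm (Gamma0 N) 2) (ϖ : ℚ) (Lsharp Lflat : IwasawaAlgebra p),
      IsNewformOf W f → (ϖ : ℝ) * W.realPeriodRat = plusPeriod f →
      IsSprungPair f p (W.frobeniusTrace p) Lsharp Lflat →
    ∀ (I : Kato2004.IwasawaH1Data W p κ γ)
      (Cs : SharpFlatColemanKatoData W p f ϖ κ γ (closureEmb (K := ℚ) (v.adicCompletion ℚ))
        (W.frobeniusTrace p) g c Chroma.sharp I)
      (Cf : SharpFlatColemanKatoData W p f ϖ κ γ (closureEmb (K := ℚ) (v.adicCompletion ℚ))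
        (W.frobeniusTrace p) g c Chroma.flat I),
      Cs.Z = Cf.Z →
    ∀ (Y : W.FineSelmerDualData κ γ) (𝔭 : PrimeSpectrum (IwasawaAlgebra p)), 𝔭.asIdeal.height = 1 →
      (p : IwasawaAlgebra p) ∉ 𝔭.asIdeal →
      (¬ ∃ n : ℕ, ((cyclotomicOmega p n).map (Int.castRingHom ℤ_[p]) : PowerSeries ℤ_[p]) ∈ 𝔭.asIdeal) →
      (∀ (col' : Chroma) (G' : IwasawaAlgebra p),
        iwasawaToPowerSeries p G' =
          PowerSeries.C (ϖ : ℚ_[p]) * iwasawaToPowerSeries p (chromaticL col' Lsharp Lflat) →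
        G' ∈ 𝔭.asIdeal) →
      Module.lengthAt (IwasawaAlgebra p) (I.H ⧸ Cs.Z) 𝔭 ≤ Module.lengthAt (IwasawaAlgebra p) Y.X 𝔭

/-! ## §A Plan A — RESHAPE R0: the weakest sufficient telescope (fact binders displayed, precedent S4a)

As registered, K_spor has NO fact binders and the composition `lowerDivisibility_of_stubs` passes it none
(l.448), while every Euler-system plan for it (k1 §B, k2 Plan A/C, k4 Plan A/B) consumes Kato's divisibility —
Sprung 2012 Thm 7.16 = `thm716_sharpFlatCharIdeal_divisibility`, a named `def … : Prop` with no `_holds` — which is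
not even a conjunct of S5 `stub_heldInputs`. So the registered signature is closable only by a fact-free argument
(none is on any card). R0: re-key the stub EXACTLY like S4a `stub_cyclotomicLowerAtT (h714) (h3) (hGZK)` and add the
Thm 7.16 conjunct to S5. Call-site patch (composition, three tokens): `obtain ⟨h714, h3, hJ, hGZK, hKob, h716⟩ :=
stub_heldInputs'` and `have hK := stub_katoFineLowerSporadic_rekeyed h714 h716 h3 W 3 hX κ γ …` (rest verbatim).
`h3` also cures k2's R1 (a normalised `G'` exists for both colours once `ϖ ∈ ℤ₃ˣ`: `stub_periodMu h3` gives `hG`). -/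

/-- **A1 — K_spor re-keyed (R0).** Same body, three displayed published facts. [cite: Sprung2012, Thm. 7.14, Thm. 7.16]
[cite: GreenbergVatsal2000, Rem. 3.4] -/
theorem stub_katoFineLowerSporadic_rekeyed
    (h714 : thm714_sharpFlatSelmerDual_finite_torsion) (h716 : thm716_sharpFlatCharIdeal_divisibility)
    (h3 : realPeriodRat_eq_unit_mul_plusPeriod_three) : KSpor := by
  sorry

/-- **A2 — S5′ = S5 ∧ Sprung 2012 Thm 7.16** (Kato's divisibility transported to `X^•`; citation-borne like the
other five conjuncts). [cite: Sprung2012, Thm. 7.16 (p. 1504)] [cite: Kato2004Asterisque, Thm. 12.5] -/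
theorem stub_heldInputs' :
    thm714_sharpFlatSelmerDual_finite_torsion ∧ realPeriodRat_eq_unit_mul_plusPeriod_three ∧
      thm714seq_sharpFlatColemanKato_zetaJoint ∧ rank_eq_analyticRank_of_analyticRank_le_one ∧
      Kobayashi2013.cor13i_sharpFlat_minOrder_eq_one ∧ thm716_sharpFlatCharIdeal_divisibility := by
  sorry

/-- The seam in the trivial direction: the registered stub implies the re-keyed one (so R0 loses nothing). -/
theorem rekeyed_of_registered (h : KSpor) :
    thm714_sharpFlatSelmerDual_finite_torsion → thm716_sharpFlatCharIdeal_divisibility →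
      realPeriodRat_eq_unit_mul_plusPeriod_three → KSpor :=
  fun _ _ _ => h

/-! ## §B Plan B — the strongest form provable today: the γ-keyed Kato sandwich and the defect element

Package telescope copied from `SharpFlatColemanKatoData.lengthAt_add_eq` (`Theorems/PrintX8SharpFlatMuDefect.lean`). -/

section PlanB

variable (W : WeierstrassCurve ℚ) [W.IsElliptic] (p : ℕ) [Fact p.Prime]

/-- **B1 — Kato's direction of the fine inequality, γ-keyed, off `(p)`:** `ℓ_𝔭 X₀ ≤ ℓ_𝔭(𝐇¹/Z)` at every
height-one `𝔭 ∌ p`, from the OUTPUT `∃ n, pⁿ·L^• ∈ char X^•` of Sprung Thm 7.16 for ONE non-zero colour (no ι,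
no `Kato2004.thm13_4…`, no `h3`: `(G₁)` and `(L^•)` differ by a power of `p` because `ϖ ∈ ℚˣ`). Route: `ℓ_𝔭 X^• ≤
ℓ_𝔭 Λ/(pⁿL^•) = ℓ_𝔭 Λ/(G₁)` (`lengthAt_le_of_charIdeal_le`-type + `lengthAt_quotient_span_singleton_mul` off `p`),
then flip the four-term identity `lengthAt_add_eq` with `ENat.le_iff_le_of_add_eq_add` (finiteness:
`lengthAt_ne_top_of_isTorsionBy`, `lengthAt_quotient_zeta_ne_top`). Size S/M.
[cite: Sprung2012, Thm. 7.16 (p. 1504), Prop. 7.19 (p. 1505)] [cite: Kato2004Asterisque, Thm. 12.5 (p. 222), §17.13 (p. 280)] -/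
theorem fine_le_zeta_offP_of_pow_mul_mem_charIdeal
    [ContinuousSMul ℤ_[p] (W.tateModule p)] [Module.Free ℤ_[p] (W.tateModule p)]
    [Module.Finite ℤ_[p] (W.tateModule p)]
    {N : ℕ} {f : CuspForm (Gamma0 N) 2} {ϖ : ℚ} {κ : ZpExtension ℚ p} {γ : Field.absoluteGaloisGroup ℚ}
    {E : Type} [Field E] [Algebra ℚ E] {ι : AlgebraicClosure ℚ →ₐ[ℚ] AlgebraicClosure E} {ap : ℤ}
    {g : Field.absoluteGaloisGroup E} {c : ℕ → localPoints W E} {col : Chroma}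
    {I : Kato2004.IwasawaH1Data W p κ γ} (C : SharpFlatColemanKatoData W p f ϖ κ γ ι ap g c col I)
    (hirr : W.HasIrreducibleModPGaloisRep p) {Lsharp Lflat G₁ : IwasawaAlgebra p}
    (hSP : IsSprungPair f p ap Lsharp Lflat) (hcol : chromaticL col Lsharp Lflat ≠ 0)
    (hG₁ : iwasawaToPowerSeries p G₁ =
      PowerSeries.C ((ϖ : ℚ) : ℚ_[p]) * iwasawaToPowerSeries p (chromaticL col Lsharp Lflat))
    (hG0 : G₁ ≠ 0)
    (D : SharpFlatSelmerDualData W κ γ ι ap g c col) [Module.Finite (IwasawaAlgebra p) D.X]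
    (hXt : Module.IsTorsion (IwasawaAlgebra p) D.X) (Y : W.FineSelmerDualData κ γ)
    (hKato : ∃ n : ℕ, (p : IwasawaAlgebra p) ^ n * chromaticL col Lsharp Lflat ∈ D.charIdeal)
    (𝔭 : PrimeSpectrum (IwasawaAlgebra p)) (h𝔭 : 𝔭.asIdeal.height = 1)
    (hp𝔭 : (p : IwasawaAlgebra p) ∉ 𝔭.asIdeal) :
    Module.lengthAt (IwasawaAlgebra p) Y.X 𝔭 ≤ Module.lengthAt (IwasawaAlgebra p) (I.H ⧸ C.Z) 𝔭 := by
  sorry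

/-- **B2 — the zeta index is bounded by EVERY non-zero colour:** `ℓ_𝔭(𝐇¹/Z) ≤ ℓ_𝔭 Λ/(G₁)` at every height-one
`𝔭` (also at `(p)`), from `image_zeta_localized` (`s·G₁ ∈ Col(Z)`, `s ∉ 𝔭`) and injectivity of `Col^•`; this is the
estimate inside the proof of `lengthAt_quotient_zeta_ne_top` (`…ColourTransfer.lean`), isolated. Size S.
[cite: Sprung2012, Thm. 7.14 (3) (p. 1504)] [cite: Kato2004Asterisque, Thm. 12.5 (p. 222)] -/
theorem zeta_le_colour
    [ContinuousSMul ℤ_[p] (W.tateModule p)] [Module.Free ℤ_[p] (W.tateModule p)]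
    [Module.Finite ℤ_[p] (W.tateModule p)]
    {N : ℕ} {f : CuspForm (Gamma0 N) 2} {ϖ : ℚ} {κ : ZpExtension ℚ p} {γ : Field.absoluteGaloisGroup ℚ}
    {E : Type} [Field E] [Algebra ℚ E] {ι : AlgebraicClosure ℚ →ₐ[ℚ] AlgebraicClosure E} {ap : ℤ}
    {g : Field.absoluteGaloisGroup E} {c : ℕ → localPoints W E} {col : Chroma}
    {I : Kato2004.IwasawaH1Data W p κ γ} (C : SharpFlatColemanKatoData W p f ϖ κ γ ι ap g c col I)
    (hirr : W.HasIrreducibleModPGaloisRep p) {Lsharp Lflat G₁ : IwasawaAlgebra p}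
    (hSP : IsSprungPair f p ap Lsharp Lflat) (hcol : chromaticL col Lsharp Lflat ≠ 0)
    (hG₁ : iwasawaToPowerSeries p G₁ =
      PowerSeries.C ((ϖ : ℚ) : ℚ_[p]) * iwasawaToPowerSeries p (chromaticL col Lsharp Lflat))
    (𝔭 : PrimeSpectrum (IwasawaAlgebra p)) (h𝔭 : 𝔭.asIdeal.height = 1) :
    Module.lengthAt (IwasawaAlgebra p) (I.H ⧸ C.Z) 𝔭 ≤
      Module.lengthAt (IwasawaAlgebra p) (IwasawaAlgebra p ⧸ Ideal.span {G₁}) 𝔭 := by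
  sorry

/-- **B3 — the Kato–Kolyvagin defect as ONE power series (colour-free off `(p)`):** there is `j ≠ 0` in `Λ` with
`ℓ_𝔭(𝐇¹/Z) = ℓ_𝔭 X₀ + ord_𝔭 j` at every height-one `𝔭 ∌ p`. Construction: `char X^• = (gen)` (`Λ` a UFD,
`charIdeal_isPrincipal_holds`), Thm 7.16 output `gen ∣ pⁿ L^•`, `j := pⁿ L^• / gen`; then `ℓ_𝔭 Λ/(G₁) = ℓ_𝔭 X^• +
ord_𝔭 j` off `p` and the four-term identity. The statement `K_spor ∧ S4b-cyc ∧ S4b-T` is «`j` is `3^μ · unit`»;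
K_spor alone is «`j` has no sporadic prime factor» (B4). Size M.
[cite: Sprung2012, Thm. 7.16, Prop. 7.19] [cite: Kato2004Asterisque, Conj. 12.10 (p. 224), §17.13 (p. 280)] -/
theorem exists_defect_offP
    [ContinuousSMul ℤ_[p] (W.tateModule p)] [Module.Free ℤ_[p] (W.tateModule p)]
    [Module.Finite ℤ_[p] (W.tateModule p)]
    {N : ℕ} {f : CuspForm (Gamma0 N) 2} {ϖ : ℚ} {κ : ZpExtension ℚ p} {γ : Field.absoluteGaloisGroup ℚ}
    {E : Type} [Field E] [Algebra ℚ E] {ι : AlgebraicClosure ℚ →ₐ[ℚ] AlgebraicClosure E} {ap : ℤ}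
    {g : Field.absoluteGaloisGroup E} {c : ℕ → localPoints W E} {col : Chroma}
    {I : Kato2004.IwasawaH1Data W p κ γ} (C : SharpFlatColemanKatoData W p f ϖ κ γ ι ap g c col I)
    (hirr : W.HasIrreducibleModPGaloisRep p) {Lsharp Lflat G₁ : IwasawaAlgebra p}
    (hSP : IsSprungPair f p ap Lsharp Lflat) (hcol : chromaticL col Lsharp Lflat ≠ 0)
    (hG₁ : iwasawaToPowerSeries p G₁ =
      PowerSeries.C ((ϖ : ℚ) : ℚ_[p]) * iwasawaToPowerSeries p (chromaticL col Lsharp Lflat))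
    (hG0 : G₁ ≠ 0)
    (D : SharpFlatSelmerDualData W κ γ ι ap g c col) [Module.Finite (IwasawaAlgebra p) D.X]
    (hXt : Module.IsTorsion (IwasawaAlgebra p) D.X) (Y : W.FineSelmerDualData κ γ)
    (hKato : ∃ n : ℕ, (p : IwasawaAlgebra p) ^ n * chromaticL col Lsharp Lflat ∈ D.charIdeal) :
    ∃ j : IwasawaAlgebra p, j ≠ 0 ∧
      ∀ (𝔭 : PrimeSpectrum (IwasawaAlgebra p)), 𝔭.asIdeal.height = 1 →
        (p : IwasawaAlgebra p) ∉ 𝔭.asIdeal →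
        Module.lengthAt (IwasawaAlgebra p) (I.H ⧸ C.Z) 𝔭 =
          Module.lengthAt (IwasawaAlgebra p) Y.X 𝔭 +
            Module.lengthAt (IwasawaAlgebra p) (IwasawaAlgebra p ⧸ Ideal.span {j}) 𝔭 := by
  sorry

/-- **B4 — K_spor's conclusion at `𝔭` ⟺ `j ∉ 𝔭`** (given B3's identity at `𝔭` and finiteness of `ℓ_𝔭 X₀`): the weakest
pointwise form of the stub is «the defect misses every sporadic common zero». Size S
(`Module.lengthAt_quotient_eq_zero_of_not_le` / `lengthAt_quotient_span_singleton` for the two directions). -/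
theorem zeta_le_fine_iff_defect_not_mem
    {M X : Type*} [AddCommGroup M] [Module (IwasawaAlgebra p) M] [AddCommGroup X] [Module (IwasawaAlgebra p) X]
    [Module.Finite (IwasawaAlgebra p) X] (hXt : Module.IsTorsion (IwasawaAlgebra p) X)
    {j : IwasawaAlgebra p} (hj0 : j ≠ 0)
    (𝔭 : PrimeSpectrum (IwasawaAlgebra p)) (h𝔭 : 𝔭.asIdeal.height = 1)
    (hdef : Module.lengthAt (IwasawaAlgebra p) M 𝔭 =
      Module.lengthAt (IwasawaAlgebra p) X 𝔭 +
        Module.lengthAt (IwasawaAlgebra p) (IwasawaAlgebra p ⧸ Ideal.span {j}) 𝔭) :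
    Module.lengthAt (IwasawaAlgebra p) M 𝔭 ≤ Module.lengthAt (IwasawaAlgebra p) X 𝔭 ↔ j ∉ 𝔭.asIdeal := by
  sorry

end PlanB

/-! ## §B′ How Plan B plugs into the RE-KEYED stub (the frame-level corollary, for the record)

Under R0, inside `stub_katoFineLowerSporadic_rekeyed h714 h716 h3`: `subst (hX.1 : p = 3)`; a non-zero colour `col₀`
from `IsSprungPair.ne_zero_or_ne_zero hf hgood hSP` (Rohrlich, tree theorem); its normalised `G₀` from
`stub_periodMu h3` (PROVED, S3); a real dual datum `D₀` from `nonempty_sharpFlatSelmerDualData_rat W κ γ v g c col₀`;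
`[Module.Finite] ∧ IsTorsion` from `h714`; `hKato` from `h716.rational …`; then B3 gives the defect `j` on the package
`C^{col₀} ∈ {Cs, Cf}` (move to `Cs` by `hZ`), and the goal at a sporadic common zero `𝔭` is `j ∉ 𝔭` (B4). What is
then LEFT is exactly «`j` has no sporadic prime factor» — Kato's Main Conjecture 12.10 off `(3)·(T)·(Φ_{3ⁿ})`, for which
no class-wide engine exists at `(3, a₃ = ±3)` (F-CIRC, Seat1G33); Plans B/C do not pretend otherwise. -/

end KatoFineSporadicK1
end Summit.BirchSwinnertonDyer.BirchSwinnertonDyer.Cruxes.SprungLowerDivisibilityAtThree
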